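import Summits.ResolutionOfSingularities.ResolutionOfSingularities.Theorems.FrobeniusLadderFInjectiveMacaulayficationGenericFibreModel
import Summits.ResolutionOfSingularities.ResolutionOfSingularities.Theorems.FrobeniusLadderFInjectiveMacaulayficationNonFullLocusClosed
import Summits.ResolutionOfSingularities.ResolutionOfSingularities.Theorems.FrobeniusLadderFInjectiveMacaulayficationTameWildSplit
import Summits.ResolutionOfSingularities.ResolutionOfSingularities.Theorems.FrobeniusLadderFInjectiveMacaulayficationPointFixableTransport
import HarnessLib

/-!
# Hole #3, dim-2 WILD stratum: `PointFixAtNonClosedWild` at `dim 𝒪_η = 2` ⟸ PFW2 (the named atomic residual), by the generic-fibre transfer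
# (crux `FInjectiveMacaulayfication` stmt-ResolutionOfSingularities-15315, chain w45a; res-L1-w45a-plan-1 R15.47 (1) «stub-3 NOW: file
# `…PointFixWildDimTwoOfPFW2.lean` — state PFW2 as an explicit Prop binder and prove `pointFixAtNonClosedWild_dimTwo_of_pfw2`»;
# typed target = res-L1-w45a-strat-1 `FC2Dim4Sig.lean` v0.5 `PointFixAtNonClosedWild`; seat res-L1-w45a-stub-3)

[OURS · L1 W4.5a] Support file (`--supports stmt-ResolutionOfSingularities-15315 --as helper`); NOT a statement of any manuscript; AI-written
(AI review is weaker than expert review). No definition, no named fact introduced: PFW2 enters as the explicit hypothesis binder `hW2`; the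
route's named fact #2 `DattaMurayama2024_fInjectiveLocusOpen` and the typed input `NonFullLocusClosed.CMLocusOpen` enter BY NAME (they make the
good locus open, which the tree's generic-fibre model `GenericFibreModel.genericFibreModel` consumes).

**PFW2 — «primary F-injectivisation of a 2-dimensional Cohen–Macaulay NON-NORMAL point of a surface with finitely many bad points»**, in the
chain's 5e currency (= `TameWildSplit.H4LocTame`'s text with `TameAt` NEGATED and the stalk dimension fixed to `2`): for every field `K` of
characteristic `p` and admissible `(X, g : X ⟶ Spec K)` (separated, locally of finite type, quasi-compact, integral, all stalks `CMCl`) with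
FINITE non-`FCl` locus, every CLOSED non-`FCl` point `b` with `𝒪_{X,b}` NOT integrally closed and `dim 𝒪_{X,b} = 2` carries a point-fix datum
`TameWildSplit.PFixData p 𝒪_{X,b}` (an `𝔪_b`-primary centre all of whose affine blow-up charts are FULL over `𝔪_b`). OPEN (plan-1 R15.47: holds on
the conical class by the tautological grading; a negative specimen × 𝔸² would refute `FCUnguardedDimGe4` as typed).

**THE TRANSFER** (`pointFixAtNonClosedWild_dimTwo_of_pfw2`): strat-1's `PointFixAtNonClosedWild` (v0.5) with `ringKrullDim 𝒪_η = 2` in place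
of `2 ≤ dim 𝒪_η ≤ 3` follows from PFW2: the good locus of `X₁` is open (`nonFullLocusClosed_of_named hDM hCMo`, all stalks CM), so the tree's
GENERIC-FIBRE MODEL (`genericFibreModel`, U16) yields an admissible `X₀ / K₀` with finite bad locus and a CLOSED bad point `b` with
`𝒪_{X₀,b} ≃+* 𝒪_{X₁,η}`; non-normality and `dim = 2` are ring-intrinsic, PFW2 gives `PFixData` at `b`, and `PFixData` transports along the ring
isomorphism (`PointFixableTransport.pointFixable_of_ringEquiv`); finally `PFixData` is repackaged as strat-1's `PointFixData` (LocFix ∧ `√ = 𝔪`).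
[folklore assembly; cite: DattaMurayama2024, Thm. B]
-/

-- single-problem summit: the doubled namespace component is forced
set_option linter.dupNamespace false

noncomputable section

open AlgebraicGeometry CategoryTheory Literature.AlgebraicGeometry.Resolution TopologicalSpace IsLocalRing

namespace Summit.ResolutionOfSingularities.ResolutionOfSingularities.Theorems.FInjectiveMacaulayfication.PointFixWildDimTwo

open Summit.ResolutionOfSingularities.ResolutionOfSingularities.Theorems.FInjectiveMacaulayfication

/-- **dim-2 wild stratum ⟸ PFW2** (see the module docstring for PFW2's text — the binder `hW2` — and the transfer).
[folklore assembly; cite: DattaMurayama2024, Thm. B] -/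
theorem pointFixAtNonClosedWild_dimTwo_of_pfw2
    (hDM : Literature.AlgebraicGeometry.Resolution.DattaMurayama2024_fInjectiveLocusOpen.{0})
    (hCMo : NonFullLocusClosed.CMLocusOpen)
    (hW2 : ∀ (p : ℕ), p.Prime → ∀ (K : Type) [Field K] [CharP K p] (X : Scheme.{0}) (g : X ⟶ Spec (.of K)),
      IsSeparated g → LocallyOfFiniteType g → QuasiCompact g → IsIntegral X →
      (∀ x : X, SliceableCentre.CMCl (X.presheaf.stalk x)) →
      Set.Finite {x : X | ¬ SliceableCentre.FCl p (X.presheaf.stalk x)} →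
      ∀ b : X, IsClosed ({b} : Set X) → ¬ SliceableCentre.FCl p (X.presheaf.stalk b) →
        ¬ IsIntegrallyClosed (X.presheaf.stalk b) → ringKrullDim (X.presheaf.stalk b) = (2 : ℕ) →
        TameWildSplit.PFixData p (X.presheaf.stalk b)) :
    ∀ (p : ℕ), p.Prime → ∀ (k : Type) [Field k] [CharP k p]
    (X₁ : Scheme.{0}) (f₁ : X₁ ⟶ Spec (.of k)),
      IsSeparated f₁ → LocallyOfFiniteType f₁ → QuasiCompact f₁ → IsIntegral X₁ → 4 ≤ topologicalKrullDim X₁ →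
      (∀ x : X₁, SliceableCentre.CMCl (X₁.presheaf.stalk x)) →
      ∀ η : X₁, ¬ IsClosed ({η} : Set X₁) → ¬ SliceableCentre.FCl p (X₁.presheaf.stalk η) →
        ringKrullDim (X₁.presheaf.stalk η) = (2 : ℕ) →
        (∀ y : X₁, y ⤳ η → y ≠ η → SliceableCentre.FCl p (X₁.presheaf.stalk y)) →
        ¬ IsIntegrallyClosed (X₁.presheaf.stalk η) →
        ∃ (n' : ℕ) (c' : Fin n' → X₁.presheaf.stalk η),
          (Ideal.span (Set.range c') ≠ ⊥ ∧ Ideal.span (Set.range c') ≤ maximalIdeal (X₁.presheaf.stalk η) ∧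
            ∀ (j : Fin n') (𝔔 : PrimeSpectrum (blowupAlgebra (Ideal.span (Set.range c')) (c' j))),
              𝔔.asIdeal.comap (algebraMap (X₁.presheaf.stalk η) (blowupAlgebra (Ideal.span (Set.range c')) (c' j))) =
                maximalIdeal (X₁.presheaf.stalk η) → SliceableCentre.FullCl p (Localization.AtPrime 𝔔.asIdeal)) ∧
          (Ideal.span (Set.range c')).radical = maximalIdeal (X₁.presheaf.stalk η) := by
  intro p hp k _ _ X₁ f₁ hsep hft hqc hint _ hCM η _ hbad hdim hgen hnn
  -- the good locus is open (#2 by name + openness of the CM locus; all stalks are CM)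
  have hclosed := NonFullLocusClosed.nonFullLocusClosed_of_named hDM hCMo p hp k X₁ f₁ hft hqc hint
  have hopen : IsOpen {x : X₁ | SliceableCentre.FCl p (X₁.presheaf.stalk x)} := by
    have hset : {x : X₁ | SliceableCentre.FCl p (X₁.presheaf.stalk x)} =
        {x : X₁ | ¬ NonFullLocusClosed.Clause p (X₁.presheaf.stalk x)}ᶜ := by
      ext x
      simp only [Set.mem_setOf_eq, Set.mem_compl_iff, not_not]
      rw [NonFullLocusClosed.clause_iff]
      exact ⟨fun h => ⟨hCM x, h⟩, fun h => h.2⟩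
    rw [hset]
    exact hclosed.isOpen_compl
  -- the generic-fibre model at `η`
  obtain ⟨K₀, instF, instC, X₀, f₀, hsep₀, hft₀, hqc₀, hint₀, hCM₀, hfin₀, b, hbcl, hbbad, ⟨e⟩⟩ :=
    GenericFibreModel.genericFibreModel p hp k X₁ f₁ hft hint hCM hopen η hbad hgen
  -- PFW2 at `b`: non-normality and the dimension are read through `e : 𝒪_{X₀,b} ≃+* 𝒪_{X₁,η}`
  have hnn₀ : ¬ IsIntegrallyClosed (X₀.presheaf.stalk b) := fun h => by
    haveI := h
    exact hnn (IsIntegrallyClosed.of_equiv e)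
  have hdim₀ : ringKrullDim (X₀.presheaf.stalk b) = (2 : ℕ) := by rw [ringKrullDim_eq_of_ringEquiv e, hdim]
  have hfix₀ := hW2 p hp K₀ X₀ f₀ hsep₀ hft₀ hqc₀ hint₀ hCM₀ hfin₀ b hbcl hbbad hnn₀ hdim₀
  -- transport to `𝒪_{X₁,η}` and repackage
  obtain ⟨n, c, hne, hrad, hcl⟩ := PointFixableTransport.pointFixable_of_ringEquiv p e hfix₀
  refine ⟨n, c, ⟨hne, ?_, fun j 𝔔 h𝔔 => hcl j 𝔔 h𝔔⟩, hrad⟩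
  rw [← hrad]
  exact Ideal.le_radical

end Summit.ResolutionOfSingularities.ResolutionOfSingularities.Theorems.FInjectiveMacaulayfication.PointFixWildDimTwo

end
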